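import Mathlib
import Literature.Computability.AlgebraicComplexity.GroupTheoreticMatMul
import Literature.Barriers.MatrixMultiplication.TricoloredSumFreeBarrier
import Summits.MatrixMultiplication.MatrixMultiplication.Theorems.GroupTheoreticSTPPCThesisPackingSumset
import Summits.MatrixMultiplication.MatrixMultiplication.Theorems.AbelianSTPPCensusIteratedRoom
import Summits.MatrixMultiplication.MatrixMultiplication.Theorems.AbelianSTPPCensusThreeRoomEnergy

/-!
# The three-room energy rule, refined count (E3⁺) (cell mm-stpp, eng-2 g4)

Same setting and ingredients as `AbelianSTPPCensusThreeRoomEnergy` (rule E3, `STPPThreeRoomEnergy.three_room_energy`): an `IsSTPP`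
family in a finite abelian group `G` of order `M`, a member `t` with block set `W = A_t − B_t + C_t`, `|W| = V = |A_t||B_t||C_t| > M/2`,
and U14⁺ slacks `s_A, s_B, s_C`; `r(g) := |W ∩ (W + g)|`.  E3 sums the single floor `r(g) ≥ θ := V − (s_A + s_B + s_C)` over `G`.
E3⁺ sums the best available floor per class of `g` inside the exact identity `Σ_g r(g) = V²` (`sum_overlap_eq_sq`):
`r(0) = V`; `r(g) ≥ V − s_X` on the punctured difference set `(X_t − X_t) ∖ {0}` (`X ∈ {A, B, C}`; these three sets are pairwise
disjoint by the TPP of member `t`, and each has at least `|X_t| − 1` elements); `r(g) ≥ θ` elsewhere.  Hence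

**E3⁺ (`three_room_energy_plus`).**  `M·θ + (V − θ) + Σ_{X ∈ {A,B,C}} (|X_t| − 1)·((V − s_X) − θ) ≤ V²`  (truncated subtractions).

Kill schema `false_of_energy3p`; instances = the three recorded vP-alive `T_E` witness leaves at orders 338–420 that survive E3:
`no_666x4_at_352` (`(6,6,6)⁴` at 352: `352·132 + 84 + 3·5·56 = 47388 > 46656`), `no_666x4_112_at_354` (`(6,6,6)⁴+(1,1,2)` at 354:
`47309 > 46656`), `no_766x4_332_at_412` (`(7,6,6)⁴+(3,3,2)` at 412: `64178 > 63504`).  With these, every one of the 844 recorded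
vP-alive `T_E` witness leaves at orders 338–420 (planner kit j247111) violates E3 or E3⁺ (seat table HOME/mm-stpp-eng-2/energy3/).
WHAT THIS IS NOT: no `ω` statement, no census row; a necessary condition; where the first order with an E3⁺-surviving leaf lies is a
separate (census) question.
-/

-- single-conjunct summit: the mandated namespace repeats `MatrixMultiplication`.
set_option linter.dupNamespace false

namespace Summit.MatrixMultiplication.MatrixMultiplication.Theorems

namespace STPPThreeRoomEnergy

open Finset Literature.Computability.AlgebraicComplexity
open scoped Pointwise

variable {G : Type*} [AddCommGroup G] [DecidableEq G]

/-! ## Counting lemmas -/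

/-- **`Σ_g |W ∩ (W + g)| = |W|²`** (ordered pairs of `W` sorted by their difference). [folklore] -/
theorem sum_overlap_eq_sq [Fintype G] (W : Finset G) :
    ∑ g, (W.filter (· - g ∈ W)).card = W.card ^ 2 := by
  rw [← card_sigma, sq, ← card_product]
  refine card_nbij' (fun x => (x.2, x.2 - x.1)) (fun p => ⟨p.1 - p.2, p.1⟩) ?_ ?_ ?_ ?_
  · intro x hx
    rw [mem_coe, mem_sigma, mem_filter] at hx
    rw [mem_coe, mem_product]
    exact ⟨hx.2.1, hx.2.2⟩
  · intro p hp
    rw [mem_coe, mem_product] at hp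
    rw [mem_coe, mem_sigma, mem_filter]
    exact ⟨mem_univ _, hp.1, by rw [sub_sub_cancel]; exact hp.2⟩
  · intro x _
    obtain ⟨g, w⟩ := x
    simp only [sub_sub_cancel]
  · intro p _
    exact Prod.ext rfl (sub_sub_cancel _ _)

/-- A punctured difference set is not small: `|X| − 1 ≤ |(X − X) ∖ {0}|` (the elements `x − x₀`, `x ≠ x₀`). [folklore] -/
theorem card_pred_le_card_sub_erase (X : Finset G) : X.card - 1 ≤ ((X - X).erase 0).card := by
  rcases X.eq_empty_or_nonempty with rfl | ⟨x₀, hx₀⟩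
  · simp
  · calc X.card - 1 = (X.erase x₀).card := (card_erase_of_mem hx₀).symm
      _ ≤ ((X - X).erase 0).card := by
          refine card_le_card_of_injOn (· - x₀) ?_ (fun a _ b _ h => sub_left_injective h)
          intro x hx
          rw [mem_coe, mem_erase] at hx
          rw [mem_coe, mem_erase]
          exact ⟨sub_ne_zero.2 hx.1, sub_mem_sub hx.2 hx₀⟩

omit [AddCommGroup G] in
/-- `Σ_{g ∈ G} [g ∈ S]·e = |S|·e`. [bookkeeping] -/
theorem sum_ite_mem_univ [Fintype G] (S : Finset G) (e : ℕ) :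
    ∑ g, (if g ∈ S then e else 0) = S.card * e := by
  rw [Finset.sum_ite_mem, univ_inter, sum_const, smul_eq_mul]

/-! ## Disjointness of the three punctured difference sets (TPP of one member) -/

variable {N : ℕ} {A B C : Fin N → Finset G}

/-- `(A_t − A_t) ∩ (B_t − B_t) = {0}` for a member of an `IsSTPP` family with `C_t ≠ ∅`. [cite: CohnKleinbergSzegedyUmans2005, Def. 5.1] -/
theorem eq_zero_of_mem_sub_A_of_mem_sub_B (h : IsSTPP A B C) (t : Fin N) (hC : (C t).Nonempty) {d : G}
    (hdA : d ∈ A t - A t) (hdB : d ∈ B t - B t) : d = 0 := by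
  obtain ⟨c, hc⟩ := hC
  rw [mem_sub] at hdA hdB
  obtain ⟨a, ha, a', ha', rfl⟩ := hdA
  obtain ⟨b, hb, b', hb', he⟩ := hdB
  have key : (a - a') + (b' - b) + (c - c) = 0 := by rw [← he]; abel
  obtain ⟨-, -, hs, -, -⟩ := h t t t a' ha' a ha b hb b' hb' c hc c hc key
  rw [hs, sub_self]

/-- `(A_t − A_t) ∩ (C_t − C_t) = {0}` (with `B_t ≠ ∅`). [cite: CohnKleinbergSzegedyUmans2005, Def. 5.1] -/
theorem eq_zero_of_mem_sub_A_of_mem_sub_C (h : IsSTPP A B C) (t : Fin N) (hB : (B t).Nonempty) {d : G}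
    (hdA : d ∈ A t - A t) (hdC : d ∈ C t - C t) : d = 0 := by
  obtain ⟨b, hb⟩ := hB
  rw [mem_sub] at hdA hdC
  obtain ⟨a, ha, a', ha', rfl⟩ := hdA
  obtain ⟨c, hc, c', hc', he⟩ := hdC
  have key : (a - a') + (b - b) + (c' - c) = 0 := by rw [← he]; abel
  obtain ⟨-, -, hs, -, -⟩ := h t t t a' ha' a ha b hb b hb c hc c' hc' key
  rw [hs, sub_self]

/-- `(B_t − B_t) ∩ (C_t − C_t) = {0}` (with `A_t ≠ ∅`). [cite: CohnKleinbergSzegedyUmans2005, Def. 5.1] -/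
theorem eq_zero_of_mem_sub_B_of_mem_sub_C (h : IsSTPP A B C) (t : Fin N) (hA : (A t).Nonempty) {d : G}
    (hdB : d ∈ B t - B t) (hdC : d ∈ C t - C t) : d = 0 := by
  obtain ⟨a, ha⟩ := hA
  rw [mem_sub] at hdB hdC
  obtain ⟨b, hb, b', hb', rfl⟩ := hdB
  obtain ⟨c, hc, c', hc', he⟩ := hdC
  have key : (a - a) + (b - b') + (c' - c) = 0 := by rw [← he]; abel
  obtain ⟨-, -, -, ht, -⟩ := h t t t a ha a ha b' hb' b hb c hc c' hc' key
  rw [ht, sub_self]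

/-! ## E3⁺ -/

variable [Fintype G]

/-- **The refined three-room energy rule (E3⁺).**  For an `IsSTPP` family with all sets non-empty in a finite abelian group `G`, a member
`t` with `V = |A_t||B_t||C_t| > |G|/2` and U14⁺ slacks `s_A, s_B, s_C` (as in `three_room_energy`), writing `θ = V − (s_A + s_B + s_C)`:
`|G|·θ + (V − θ) + (|A_t| − 1)·((V − s_A) − θ) + (|B_t| − 1)·((V − s_B) − θ) + (|C_t| − 1)·((V − s_C) − θ) ≤ V²`
(all subtractions truncated). [original] -/
theorem three_room_energy_plus (h : IsSTPP A B C) (hA : ∀ u, (A u).Nonempty) (hB : ∀ u, (B u).Nonempty)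
    (hC : ∀ u, (C u).Nonempty) (t : Fin N) (sA sB sC : ℕ)
    (hsA : Fintype.card G ≤ (A t).card * (B t).card * (C t).card +
      (∑ u ∈ univ.erase t, (B u).card * (C u).card) + sA)
    (hsB : Fintype.card G ≤ (A t).card * (B t).card * (C t).card +
      (∑ u ∈ univ.erase t, (C u).card * (A u).card) + sB)
    (hsC : Fintype.card G ≤ (A t).card * (B t).card * (C t).card +
      (∑ u ∈ univ.erase t, (A u).card * (B u).card) + sC)
    (hbig : Fintype.card G < 2 * ((A t).card * (B t).card * (C t).card)) :
    Fintype.card G * ((A t).card * (B t).card * (C t).card - (sA + sB + sC)) +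
      ((A t).card * (B t).card * (C t).card - ((A t).card * (B t).card * (C t).card - (sA + sB + sC))) +
      ((A t).card - 1) * (((A t).card * (B t).card * (C t).card - sA) -
        ((A t).card * (B t).card * (C t).card - (sA + sB + sC))) +
      ((B t).card - 1) * (((A t).card * (B t).card * (C t).card - sB) -
        ((A t).card * (B t).card * (C t).card - (sA + sB + sC))) +
      ((C t).card - 1) * (((A t).card * (B t).card * (C t).card - sC) -
        ((A t).card * (B t).card * (C t).card - (sA + sB + sC))) ≤
      ((A t).card * (B t).card * (C t).card) ^ 2 := by
  set W := A t - B t + C t with hW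
  set V := (A t).card * (B t).card * (C t).card with hVdef
  have hV : W.card = V := STPPIteratedRoom.card_sub_add_eq h t
  set θ := V - (sA + sB + sC) with hθ
  set eA := (V - sA) - θ with heA
  set eB := (V - sB) - θ with heB
  set eC := (V - sC) - θ with heC
  set PA := (A t - A t).erase 0 with hPA
  set PB := (B t - B t).erase 0 with hPB
  set PC := (C t - C t).erase 0 with hPC
  -- the floor function
  set f : G → ℕ := fun g => θ + (if g = 0 then V - θ else 0) + (if g ∈ PA then eA else 0) +
    (if g ∈ PB then eB else 0) + (if g ∈ PC then eC else 0) with hf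
  have key : ∀ g, f g ≤ (W.filter (· - g ∈ W)).card := by
    intro g
    have h0 := popular_all h hA hB hC t sA sB sC hsA hsB hsC hbig g
    rw [← hW, hV] at h0
    by_cases hg : g = 0
    · subst hg
      have hz := STPPIteratedRoom.overlap_zero W
      have n1 : (0 : G) ∉ PA := fun hm => (mem_erase.1 hm).1 rfl
      have n2 : (0 : G) ∉ PB := fun hm => (mem_erase.1 hm).1 rfl
      have n3 : (0 : G) ∉ PC := fun hm => (mem_erase.1 hm).1 rfl
      simp only [hf, if_true, if_neg n1, if_neg n2, if_neg n3, add_zero]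
      rw [hz, hV]; omega
    · by_cases hgA : g ∈ PA
      · have n2 : g ∉ PB := fun hm =>
          hg (eq_zero_of_mem_sub_A_of_mem_sub_B h t (hC t) (mem_erase.1 hgA).2 (mem_erase.1 hm).2)
        have n3 : g ∉ PC := fun hm =>
          hg (eq_zero_of_mem_sub_A_of_mem_sub_C h t (hB t) (mem_erase.1 hgA).2 (mem_erase.1 hm).2)
        have h1 := popular_A h hA t sA hsA g (mem_erase.1 hgA).2
        rw [← hW, hV] at h1
        simp only [hf, if_neg hg, if_pos hgA, if_neg n2, if_neg n3, add_zero]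
        omega
      · by_cases hgB : g ∈ PB
        · have n3 : g ∉ PC := fun hm =>
            hg (eq_zero_of_mem_sub_B_of_mem_sub_C h t (hA t) (mem_erase.1 hgB).2 (mem_erase.1 hm).2)
          have h1 := popular_B h hA hB t sB hsB g (mem_erase.1 hgB).2
          rw [← hW, hV] at h1
          simp only [hf, if_neg hg, if_neg hgA, if_pos hgB, if_neg n3, add_zero]
          omega
        · by_cases hgC : g ∈ PC
          · have h1 := STPPIteratedRoom.room_popular h hC t sC hsC g (mem_erase.1 hgC).2
            rw [← hW, hV] at h1
            simp only [hf, if_neg hg, if_neg hgA, if_neg hgB, if_pos hgC, add_zero]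
            omega
          · simp only [hf, if_neg hg, if_neg hgA, if_neg hgB, if_neg hgC, add_zero]
            omega
  -- summing the floors
  have hsum : ∑ g, f g = Fintype.card G * θ + (V - θ) + PA.card * eA + PB.card * eB + PC.card * eC := by
    simp only [hf, sum_add_distrib, sum_const, card_univ, smul_eq_mul, sum_ite_eq', mem_univ, if_true,
      sum_ite_mem_univ]
  have hle : ∑ g, f g ≤ V ^ 2 := by
    rw [← hV, ← sum_overlap_eq_sq W]; exact sum_le_sum fun g _ => key g
  have hPA := card_pred_le_card_sub_erase (A t)
  have hPB := card_pred_le_card_sub_erase (B t)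
  have hPC := card_pred_le_card_sub_erase (C t)
  calc Fintype.card G * θ + (V - θ) + ((A t).card - 1) * eA + ((B t).card - 1) * eB + ((C t).card - 1) * eC
      ≤ Fintype.card G * θ + (V - θ) + PA.card * eA + PB.card * eB + PC.card * eC := by gcongr
    _ = ∑ g, f g := hsum.symm
    _ ≤ V ^ 2 := hle

/-! ## Kill schema on shape data -/

/-- **Kill schema (E3⁺).**  Shape data `a, b, c` (all positive) of an `IsSTPP` family in an abelian group of order `M`, a member `t`
with `V = a_t b_t c_t > M/2`, off-member packing sums `S_A = Σ_{u≠t} b_u c_u`, `S_B = Σ_{u≠t} c_u a_u`, `S_C = Σ_{u≠t} a_u b_u`,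
slacks `s_X = M − (V + S_X)` and `θ = V − (s_A + s_B + s_C)` (all truncated): if
`V² < M·θ + (V − θ) + (a_t − 1)((V − s_A) − θ) + (b_t − 1)((V − s_B) − θ) + (c_t − 1)((V − s_C) − θ)`, the family does not exist.
[original] -/
theorem false_of_energy3p (h : IsSTPP A B C) {a b c : Fin N → ℕ} (ha : ∀ r, (A r).card = a r)
    (hb : ∀ r, (B r).card = b r) (hc : ∀ r, (C r).card = c r) (hpos : ∀ r, 0 < a r ∧ 0 < b r ∧ 0 < c r)
    {M : ℕ} (hM : Fintype.card G = M) (t : Fin N) (SA SB SC : ℕ)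
    (hSA : SA = ∑ u ∈ univ.erase t, b u * c u) (hSB : SB = ∑ u ∈ univ.erase t, c u * a u)
    (hSC : SC = ∑ u ∈ univ.erase t, a u * b u) (hbig : M < 2 * (a t * b t * c t))
    (hkill : (a t * b t * c t) ^ 2 <
      M * (a t * b t * c t - ((M - (a t * b t * c t + SA)) + (M - (a t * b t * c t + SB)) +
        (M - (a t * b t * c t + SC)))) +
      (a t * b t * c t - (a t * b t * c t - ((M - (a t * b t * c t + SA)) + (M - (a t * b t * c t + SB)) +
        (M - (a t * b t * c t + SC))))) +
      (a t - 1) * ((a t * b t * c t - (M - (a t * b t * c t + SA))) - (a t * b t * c t -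
        ((M - (a t * b t * c t + SA)) + (M - (a t * b t * c t + SB)) + (M - (a t * b t * c t + SC))))) +
      (b t - 1) * ((a t * b t * c t - (M - (a t * b t * c t + SB))) - (a t * b t * c t -
        ((M - (a t * b t * c t + SA)) + (M - (a t * b t * c t + SB)) + (M - (a t * b t * c t + SC))))) +
      (c t - 1) * ((a t * b t * c t - (M - (a t * b t * c t + SC))) - (a t * b t * c t -
        ((M - (a t * b t * c t + SA)) + (M - (a t * b t * c t + SB)) + (M - (a t * b t * c t + SC)))))) :
    False := by
  classical
  have hA : ∀ u, (A u).Nonempty := fun u => card_pos.1 (by rw [ha u]; exact (hpos u).1)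
  have hB : ∀ u, (B u).Nonempty := fun u => card_pos.1 (by rw [hb u]; exact (hpos u).2.1)
  have hC : ∀ u, (C u).Nonempty := fun u => card_pos.1 (by rw [hc u]; exact (hpos u).2.2)
  have eA : ∑ u ∈ univ.erase t, (B u).card * (C u).card = SA := by
    rw [hSA]; exact sum_congr rfl fun u _ => by rw [hb u, hc u]
  have eB : ∑ u ∈ univ.erase t, (C u).card * (A u).card = SB := by
    rw [hSB]; exact sum_congr rfl fun u _ => by rw [hc u, ha u]
  have eC : ∑ u ∈ univ.erase t, (A u).card * (B u).card = SC := by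
    rw [hSC]; exact sum_congr rfl fun u _ => by rw [ha u, hb u]
  have := three_room_energy_plus h hA hB hC t (M - (a t * b t * c t + SA)) (M - (a t * b t * c t + SB))
    (M - (a t * b t * c t + SC)) (by rw [eA, ha t, hb t, hc t, hM]; omega)
    (by rw [eB, ha t, hb t, hc t, hM]; omega) (by rw [eC, ha t, hb t, hc t, hM]; omega)
    (by rw [ha t, hb t, hc t, hM]; exact hbig)
  rw [ha t, hb t, hc t, hM] at this
  exact absurd this (not_le.2 hkill)

/-! ## Instances: the E3-survivors among the recorded vP-alive `T_E` witnesses at orders 338–420 -/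

/-- **Order 352, shapes `(6,6,6)⁴`: impossible** (passes E3: `352·132 = 46464 ≤ 46656`; E3⁺: `46464 + 84 + 3·5·56 = 47388 > 46656`).
[original] -/
theorem no_666x4_at_352 {A B C : Fin 4 → Finset G} (h : IsSTPP A B C)
    (hA : ∀ r, (A r).card = ![6, 6, 6, 6] r) (hB : ∀ r, (B r).card = ![6, 6, 6, 6] r)
    (hC : ∀ r, (C r).card = ![6, 6, 6, 6] r) (hM : Fintype.card G = 352) : False :=
  false_of_energy3p h hA hB hC (by decide) hM 0 108 108 108 (by decide) (by decide) (by decide) (by decide) (by decide)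

/-- **Order 354, shapes `(6,6,6)⁴ + (1,1,2)`: impossible** (member `0`: slacks `28, 28, 29`, `θ = 131`;
`354·131 + 85 + 5·(57 + 57 + 56) = 47309 > 46656`). [original] -/
theorem no_666x4_112_at_354 {A B C : Fin 5 → Finset G} (h : IsSTPP A B C)
    (hA : ∀ r, (A r).card = ![6, 6, 6, 6, 1] r) (hB : ∀ r, (B r).card = ![6, 6, 6, 6, 1] r)
    (hC : ∀ r, (C r).card = ![6, 6, 6, 6, 2] r) (hM : Fintype.card G = 354) : False :=
  false_of_energy3p h hA hB hC (by decide) hM 0 110 110 109 (by decide) (by decide) (by decide) (by decide) (by decide)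

/-- **Order 412, shapes `(7,6,6)⁴ + (3,3,2)`: impossible** (member `0`: `V = 252`, slacks `46, 28, 25`, `θ = 153`;
`412·153 + 99 + 6·53 + 5·71 + 5·74 = 64178 > 63504 = 252²`). [original] -/
theorem no_766x4_332_at_412 {A B C : Fin 5 → Finset G} (h : IsSTPP A B C)
    (hA : ∀ r, (A r).card = ![7, 7, 7, 7, 3] r) (hB : ∀ r, (B r).card = ![6, 6, 6, 6, 3] r)
    (hC : ∀ r, (C r).card = ![6, 6, 6, 6, 2] r) (hM : Fintype.card G = 412) : False :=
  false_of_energy3p h hA hB hC (by decide) hM 0 114 132 135 (by decide) (by decide) (by decide) (by decide) (by decide)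

/-! ## Instances appended 2026-08-27 (eng-2 g4): the first vP-alive `T_D` list and the asymptotic `T_E` blindness family -/

/-- **Order 648, shapes `(9,7,7),(7,9,7),(8,7,8),(7,8,8),(4,4,6)`: impossible** (the first list alive under vP for the tier
`T_D` (`τ = 2.47`), SUCCESSOR-BRIEF §1 row Q-i/648; member `0`: `V = 441 > 324`, off-member sums `S_A = 207, S_B = 193, S_C = 191`,
slacks `0, 14, 16` — already E3 kills it: `648 · 411 = 266328 > 194481 = 441²`). [original] -/
theorem no_977_797_878_788_446_at_648 {A B C : Fin 5 → Finset G} (h : IsSTPP A B C)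
    (hA : ∀ r, (A r).card = ![9, 7, 8, 7, 4] r) (hB : ∀ r, (B r).card = ![7, 9, 7, 8, 4] r)
    (hC : ∀ r, (C r).card = ![7, 7, 8, 8, 6] r) (hM : Fintype.card G = 648) : False :=
  false_of_energy3p h hA hB hC (by decide) hM 0 207 193 191 (by decide) (by decide) (by decide) (by decide) (by decide)

/-- **Order 6144, shapes `(16,16,16) × 8`: impossible** — the family by which `AbelianSTPPCensusVP.vpCensusTE_false_above_6144` shows the
shape sieve vP blind at every `M ≥ 6144` (`(16,16,16) × ⌊M/768⌋`) is killed by E3 at `M = 6144` itself (member `0`: `V = 4096 > 3072`,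
off-member sums `1792` each, slacks `256` each, `θ = 3328`, `6144 · 3328 = 20447232 > 16777216 = 4096²`); seat arithmetic: E3⁺ kills that
family exactly for `6144 ≤ M ≤ 6379` and is silent from `M = 8192` on (`2V ≤ M`), so the asymptotic blindness itself survives E3/E3⁺. [original] -/
theorem no_16x3_x8_at_6144 {A B C : Fin 8 → Finset G} (h : IsSTPP A B C)
    (hA : ∀ r, (A r).card = 16) (hB : ∀ r, (B r).card = 16) (hC : ∀ r, (C r).card = 16)
    (hM : Fintype.card G = 6144) : False :=
  false_of_energy3p (a := fun _ => 16) (b := fun _ => 16) (c := fun _ => 16) h hA hB hC (by decide) hM 0 1792 1792 1792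
    (by decide) (by decide) (by decide) (by decide) (by decide)

end STPPThreeRoomEnergy

end Summit.MatrixMultiplication.MatrixMultiplication.Theorems
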